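import Summits.QuantumFields.YangMills.Theorems.UnitScaleTiltProp7CovLogTowerOfRegPrT3
import Summits.QuantumFields.YangMills.Theorems.UnitScaleTiltProp7TwistedOneStepDefectOfRegPr
import HarnessLib

/-!
# Route `UnitScaleTilt`, crux K1 «MinimiserStabilityRegPr» (stmt-QuantumFields-19200), E′ architecture (A′) «HCOW-VIA-Σ», package P-A2 «JOINT-Σ» — THE F0″∘F1″ SEAM AT THE MEMBER:
# `Σ_c ‖C^{twS}_{U₀}(X)(c)‖ ≤ Σ_{l<K−n} κ^{K−n−1−l} · (10⁹L⁴ · Σ_b ‖Fm l X b‖²)` for `U₀ ∈ 𝔘_k(ε₀)`, `‖X‖ < e·η`, `10⁹L²e ≤ 1`, `10¹²L³ε₀ ≤ 1`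
# (px18 g3 ✓`Prop7CovLogTowerOfRegPr.l1_CmapTwS_le_damped_defects_of_regPr` ∘ SUP-SEAM ∘ px15 g3 ✓`Prop7TwistedOneStepDefectOfRegPr.sum_norm_chartField_sub_fderiv_apply_le_of_regPr`)

Cell `ym3-torus`, extra width seat `ym-routeR-w6` (gen 7).  THEOREMS ONLY (0 `def`, 0 `sorry`); `--supports stmt-QuantumFields-19200`, count-neutral.  YM₃ on T³ is a ladder rung (R3), not
the Clay problem; nothing here claims a stub, the crux, d = 4 or the mass gap.  F4″ (the knit against ✓`jointRow_of_levelMasses[_q]` with F2″-COV's `κ` and F3″'s level masses) is the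
namer's∕★routeR-w3's; this file only plugs F1″'s member row into F0″'s damped telescope, so the assembler reads ONE inequality in level-mass currency.

WHAT IS PROVED (ns `…Theorems.Prop7TwistedDefectDampedLevelMasses`).
* `norm_iterate_apply_le_of_regPr` — SUP-SEAM: along the log tower `Fm` of a printed-regular background, `‖Fm l X b‖ ≤ 6(2e + 2700Lε₀)` for `l ≤ K − n`, `‖X‖ < e·η`
  (✓`Prop7CovLogTower.logTower_eq_iterate` + ✓`level_window_of_regPr` + `norm_mlog_le_two_mul`).
* ★★★ `l1_CmapTwS_le_damped_levelMasses` — the title; displayed: the formal towers `Fm`, `Lin` (✓`exists_iterate`∕`exists_lin`) and F2″-COV's column-sum letter `κ` (`hT`).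
References: T. Bałaban, CMP 98 (1985) 17–51 [Balaban1985Averaging] ((127) p.36, (150)–(152) pp.40–41); CMP 102 (1985) 277–309 [Balaban1985Variational] ((44) p.285, Prop. 7 p.299).
-/

set_option autoImplicit false

noncomputable section

open scoped BigOperators Matrix.Norms.L2Operator
open NormedSpace
open Literature.MathematicalPhysics.QuantumFieldTheory.Balaban1983to89
open Literature.MathematicalPhysics.QuantumFieldTheory.Balaban1983to89.T3ContinuumYM3Torus
open T4Continuum BlockAveraging AveragingRT ExpMeanLog
open MatrixLog (mlog norm_mlog_le_two_mul)
open B7Prop1Explicit (expUnit val_expUnit)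
open T3PrintedRegularMinimiser (RegPr)
open T3SectALandauChart (eta eta_pos bgUnits)
open Summit.QuantumFields.YangMills.Theorems.Prop8Chart (emlAvgU emlIterU)
open Summit.QuantumFields.YangMills.Theorems.Prop7SymAvgTwSym (dbarCovU dbarCovIterU CmapTwS)
open Summit.QuantumFields.YangMills.Theorems.Prop7CovLogTower (logTower_eq_iterate)
open Summit.QuantumFields.YangMills.Theorems.Prop7CovLogTowerOfRegPr (l1_CmapTwS_le_damped_defects_of_regPr hwinr_of_regPr level_window_of_regPr three_window_le_half)
open Summit.QuantumFields.YangMills.Theorems.Prop7TwistedOneStepDefectOfRegPr (sum_norm_chartField_sub_fderiv_apply_le_of_regPr)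

namespace Summit.QuantumFields.YangMills.Theorems.Prop7TwistedDefectDampedLevelMasses

variable (F : T3Family) {n K : ℕ} (h : n ≤ K)

/-- **SUP-SEAM**: along the log tower of a printed-regular background, `‖Fm l X b‖ ≤ 6(2e + 2700Lε₀)` for `l ≤ K − n`, `‖X‖ < e·η` (round trip ✓`logTower_eq_iterate`, (W1) at every level
✓`level_window_of_regPr`, `‖log u‖ ≤ 2‖u − 1‖`). [cite: Balaban1985Averaging, (127) p.36, (161)–(163) p.42] -/
theorem norm_iterate_apply_le_of_regPr {ε₀ e : ℝ} (hε₀ : 0 < ε₀) (he : 0 < e) (hWe : 10 ^ 9 * (F.L : ℝ) ^ 2 * e ≤ 1) (hWε : 10 ^ 12 * (F.L : ℝ) ^ 3 * ε₀ ≤ 1)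
    (U₀ : GaugeField (F.P K) 0 (Matrix.specialUnitaryGroup (Fin 2) ℂ)) (hreg : RegPr F n K ε₀ U₀)
    (Fm : (m : ℕ) → (PBond (F.P K) 0 → Matrix (Fin 2) (Fin 2) ℂ) → (PBond (F.P K) m → Matrix (Fin 2) (Fin 2) ℂ)) (hF0 : ∀ x, Fm 0 x = x)
    (hFs : ∀ (m : ℕ) (x : PBond (F.P K) 0 → Matrix (Fin 2) (Fin 2) ℂ), Fm (m + 1) x =
        (fun y : PBond (F.P K) m → Matrix (Fin 2) (Fin 2) ℂ => fun c : PBond (F.P K) (m + 1) =>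
          mlog (((dbarCovU (emlIterU m (bgUnits F K U₀)) (fun b => expUnit (y b) * emlIterU m (bgUnits F K U₀) b) c : (Matrix (Fin 2) (Fin 2) ℂ)ˣ) : Matrix (Fin 2) (Fin 2) ℂ) *
            (((emlAvgU (emlIterU m (bgUnits F K U₀)) c)⁻¹ : (Matrix (Fin 2) (Fin 2) ℂ)ˣ) : Matrix (Fin 2) (Fin 2) ℂ))) (Fm m x))
    (X : PBond (F.P K) 0 → Matrix (Fin 2) (Fin 2) ℂ) (hXr : ‖X‖ < e * eta F n K) {l : ℕ} (hl : l ≤ K - n) (b : PBond (F.P K) l) :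
    ‖Fm l X b‖ ≤ 6 * (2 * e + 2700 * (F.L : ℝ) * ε₀) := by
  obtain ⟨hX5, hwin⟩ := hwinr_of_regPr F n K hε₀ he.le hWe hWε U₀ hreg X hXr
  have hwin' : ∀ m, m < l → ∀ b' : PBond (F.P K) m,
      ‖((dbarCovIterU m (bgUnits F K U₀) (fun b'' => expUnit (X b'') * bgUnits F K U₀ b'') b' : (Matrix (Fin 2) (Fin 2) ℂ)ˣ) : Matrix (Fin 2) (Fin 2) ℂ) *
          (((emlIterU m (bgUnits F K U₀) b')⁻¹ : (Matrix (Fin 2) (Fin 2) ℂ)ˣ) : Matrix (Fin 2) (Fin 2) ℂ) - 1‖ < 1 :=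
    fun m hm b' => hwin m (by omega) b'
  have hid := logTower_eq_iterate (bgUnits F K U₀) Fm hF0 hFs X hX5 l hwin' l le_rfl b
  rw [← hid]
  have hq := level_window_of_regPr F hε₀ he.le hWe hWε U₀ hreg X (fun b' => (norm_le_pi_norm X b').trans hXr.le) hl b
  have hhalf := three_window_le_half F hε₀ hWe hWε
  calc _ ≤ 2 * ‖((dbarCovIterU l (bgUnits F K U₀) (fun b' => expUnit (X b') * bgUnits F K U₀ b') b : (Matrix (Fin 2) (Fin 2) ℂ)ˣ) : Matrix (Fin 2) (Fin 2) ℂ) *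
          (((emlIterU l (bgUnits F K U₀) b)⁻¹ : (Matrix (Fin 2) (Fin 2) ℂ)ˣ) : Matrix (Fin 2) (Fin 2) ℂ) - 1‖ := norm_mlog_le_two_mul (hq.trans hhalf)
    _ ≤ 2 * (3 * (2 * e + 2700 * (F.L : ℝ) * ε₀)) := by linarith
    _ = 6 * (2 * e + 2700 * (F.L : ℝ) * ε₀) := by ring

/-- ★★★ **F0″∘F1″ AT THE MEMBER — the twisted chart remainder in ℓ¹ against the DAMPED LEVEL MASSES of the log tower**, only F2″-COV's `κ` displayed:
`Σ_c ‖C^{twS}(X)(c)‖ ≤ Σ_{l<K−n} κ^{K−n−1−l}·(10⁹L⁴·Σ_b‖Fm l X b‖²)`. [cite: Balaban1985Averaging, (150)–(152) pp.40–41; Balaban1985Variational, (44) p.285, Prop. 7 p.299] -/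
theorem l1_CmapTwS_le_damped_levelMasses {ε₀ e : ℝ} (hε₀ : 0 < ε₀) (he : 0 < e) (hWe : 10 ^ 9 * (F.L : ℝ) ^ 2 * e ≤ 1) (hWε : 10 ^ 12 * (F.L : ℝ) ^ 3 * ε₀ ≤ 1)
    (U₀ : GaugeField (F.P K) 0 (Matrix.specialUnitaryGroup (Fin 2) ℂ)) (hreg : RegPr F n K ε₀ U₀)
    (Fm : (m : ℕ) → (PBond (F.P K) 0 → Matrix (Fin 2) (Fin 2) ℂ) → (PBond (F.P K) m → Matrix (Fin 2) (Fin 2) ℂ)) (hF0 : ∀ x, Fm 0 x = x)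
    (hFs : ∀ (m : ℕ) (x : PBond (F.P K) 0 → Matrix (Fin 2) (Fin 2) ℂ), Fm (m + 1) x =
        (fun y : PBond (F.P K) m → Matrix (Fin 2) (Fin 2) ℂ => fun c : PBond (F.P K) (m + 1) =>
          mlog (((dbarCovU (emlIterU m (bgUnits F K U₀)) (fun b => expUnit (y b) * emlIterU m (bgUnits F K U₀) b) c : (Matrix (Fin 2) (Fin 2) ℂ)ˣ) : Matrix (Fin 2) (Fin 2) ℂ) *
            (((emlAvgU (emlIterU m (bgUnits F K U₀)) c)⁻¹ : (Matrix (Fin 2) (Fin 2) ℂ)ˣ) : Matrix (Fin 2) (Fin 2) ℂ))) (Fm m x))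
    (Lin : (m : ℕ) → (PBond (F.P K) 0 → Matrix (Fin 2) (Fin 2) ℂ) →L[ℂ] (PBond (F.P K) m → Matrix (Fin 2) (Fin 2) ℂ))
    (hLin0 : Lin 0 = ContinuousLinearMap.id ℂ (PBond (F.P K) 0 → Matrix (Fin 2) (Fin 2) ℂ))
    (hLins : ∀ m : ℕ, Lin (m + 1) =
        (fderiv ℂ (fun y : PBond (F.P K) m → Matrix (Fin 2) (Fin 2) ℂ => fun c : PBond (F.P K) (m + 1) =>
          mlog (((dbarCovU (emlIterU m (bgUnits F K U₀)) (fun b => expUnit (y b) * emlIterU m (bgUnits F K U₀) b) c : (Matrix (Fin 2) (Fin 2) ℂ)ˣ) : Matrix (Fin 2) (Fin 2) ℂ) *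
            (((emlAvgU (emlIterU m (bgUnits F K U₀)) c)⁻¹ : (Matrix (Fin 2) (Fin 2) ℂ)ˣ) : Matrix (Fin 2) (Fin 2) ℂ))) 0).comp (Lin m))
    {κ : ℝ} (hκ : 0 ≤ κ)
    (hT : ∀ m : ℕ, m < K - n → ∀ v : PBond (F.P K) m → Matrix (Fin 2) (Fin 2) ℂ, ∑ c, ‖fderiv ℂ (fun y : PBond (F.P K) m → Matrix (Fin 2) (Fin 2) ℂ => fun c : PBond (F.P K) (m + 1) =>
          mlog (((dbarCovU (emlIterU m (bgUnits F K U₀)) (fun b => expUnit (y b) * emlIterU m (bgUnits F K U₀) b) c : (Matrix (Fin 2) (Fin 2) ℂ)ˣ) : Matrix (Fin 2) (Fin 2) ℂ) *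
            (((emlAvgU (emlIterU m (bgUnits F K U₀)) c)⁻¹ : (Matrix (Fin 2) (Fin 2) ℂ)ˣ) : Matrix (Fin 2) (Fin 2) ℂ))) 0 v c‖ ≤ κ * ∑ c', ‖v c'‖)
    (X : PBond (F.P K) 0 → Matrix (Fin 2) (Fin 2) ℂ) (hXr : ‖X‖ < e * eta F n K) :
    ∑ c : PBond (F.P n) 0, ‖CmapTwS F n K h U₀ X c‖ ≤
      ∑ l ∈ Finset.range (K - n), κ ^ (K - n - 1 - l) * (10 ^ 9 * (F.L : ℝ) ^ 4 * ∑ b : PBond (F.P K) l, ‖Fm l X b‖ ^ 2) := by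
  have hε7 : 10 ^ 7 * (F.L : ℝ) ^ 3 * ε₀ ≤ 1 := by
    have hL0 : (0 : ℝ) ≤ (F.L : ℝ) ^ 3 := by positivity
    nlinarith [mul_nonneg hL0 hε₀.le]
  set s : ℝ := 6 * (2 * e + 2700 * (F.L : ℝ) * ε₀) with hs
  have hs0 : 0 ≤ s := by rw [hs]; have : (0:ℝ) ≤ F.L := Nat.cast_nonneg _; positivity
  have hsL : 100000 * (F.L : ℝ) * s ≤ 1 := by
    have hL1 : (1 : ℝ) ≤ F.L := by exact_mod_cast F.hL.2.le
    have hL0 : (0 : ℝ) ≤ F.L := by linarith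
    rw [hs]
    have h1 : 100000 * (F.L : ℝ) * (6 * (2 * e)) ≤ 1 / 4 := by nlinarith [mul_nonneg hL0 he.le]
    have h2 : 100000 * (F.L : ℝ) * (6 * (2700 * (F.L : ℝ) * ε₀)) ≤ 1 / 4 := by nlinarith [mul_nonneg hL0 hε₀.le, mul_nonneg (mul_nonneg hL0 hL0) hε₀.le]
    nlinarith
  refine (l1_CmapTwS_le_damped_defects_of_regPr F n K h hε₀ he hWe hWε U₀ hreg Fm hF0 hFs Lin hLin0 hLins hκ hT X hXr).trans
    (Finset.sum_le_sum fun l hl => mul_le_mul_of_nonneg_left ?_ (pow_nonneg hκ _))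
  have hl' : l + 1 ≤ K - n := Finset.mem_range.1 hl
  have hy : ∀ b : PBond (F.P K) l, ‖Fm l X b‖ ≤ s := fun b =>
    norm_iterate_apply_le_of_regPr F hε₀ he hWe hWε U₀ hreg Fm hF0 hFs X hXr (by omega) b
  have hrow := sum_norm_chartField_sub_fderiv_apply_le_of_regPr (F := F) (n := n) (K := K) hε7 hreg hl' hs0 hsL hy
  refine le_trans (le_of_eq ?_) hrow
  rfl

end Summit.QuantumFields.YangMills.Theorems.Prop7TwistedDefectDampedLevelMasses

end
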